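import Literature.MathematicalPhysics.QuantumLattice.PatchPairOperator
import HarnessLib

/-!
# Two-sided density of states at the Fermi level with `d`-wave weight
(solo-blind programme, Theorem 27 = item E5a of the `U = 0` book-end)

For the tight-binding band `ε_L(k) = -2(cos p₁ + cos p₂)`, `p_i = 2πk_i/L`, on the discrete torus
and the `d`-wave profile `w_d(k) = 2√2 (cos p₁ - cos p₂)`, we prove an elementary LOWER bound on
the number of momenta in a thin energy shell just above / just below a level `μ ∈ [-2, 0]` that
also carry a non-small `d`-wave weight:

* `card_shell_above_ge` : `#{k : μ < ε_L(k) ≤ μ + η, |w_d(k)| ≥ √2/2} ≥ (L/16π - 2)(3ηL/16π - 2)`,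
* `card_shell_below_ge` : `#{k : μ - η ≤ ε_L(k) < μ, |w_d(k)| ≥ √2/2} ≥ (L/16π - 2)(3ηL/16π - 2)`,

for `0 < η ≤ 1/2`, `L ≥ 32π`, `3ηL ≥ 32π` (so both factors are nonnegative): `≥ c η L²` momenta,
uniformly in `L`, down to shells of width `η ≍ 1/L`.  METHOD (column counting, no geometry of
level sets): in the columns `p₁ ∈ [φ₁, φ₁ + 1/8]`, `φ₁ = arccos(-μ/2 - 3/4)`, the level
`c = -cos p₁ - μ/2` of `cos p₂` on the Fermi surface lies in `[3/4, 7/8]`, so `θ* = arccos c ∈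
[1/2, π - 1/2]`; the residues `p₂ ∈ [θ* + η/8, θ* + η/2]` (resp. `[θ* - η/2, θ* - η/8]`) have
`0 < c - cos p₂ ≤ η/2` (resp. `0 < cos p₂ - c ≤ η/2`) because `cos` is strictly decreasing and
1-Lipschitz on `[0, π]`, i.e. `0 < ±(ε - μ) ≤ η`; and `|cos p₁ - cos p₂| ≥ |2cos p₁ + μ/2| - η/2
≥ 1/4`.  Integers in a real window of length `ℓ` number `≥ ℓ - 2`.

This is the density-of-states input for the lattice Cooper logarithm (report §5.20 (6), item E5;
claim C53). [this work; elementary]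
-/

noncomputable section

namespace Summit.HubbardSuperconductivity.HubbardSuperconductivity.Theorems.FermiSurfaceDOS

open Finset Real Literature.Probability.LatticeModels Literature.MathematicalPhysics.QuantumLattice

/-! ### Integers in a real window; two trigonometric constants -/

/-- Integers in `[x, y]` (`0 ≤ x ≤ y`): a block `A, A+1, …, A+n-1` with `n ≥ y - x - 2`.
[folklore] -/
theorem exists_nat_window {x y : ℝ} (hx : 0 ≤ x) (hxy : x ≤ y) :
    ∃ A n : ℕ, y - x - 2 ≤ n ∧ ∀ j < n, x ≤ ((A + j : ℕ) : ℝ) ∧ ((A + j : ℕ) : ℝ) ≤ y := by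
  refine ⟨⌈x⌉₊, ⌊y⌋₊ - ⌈x⌉₊, ?_, ?_⟩
  · have h1 : (⌈x⌉₊ : ℝ) < x + 1 := Nat.ceil_lt_add_one hx
    have h2 : y - 1 < (⌊y⌋₊ : ℝ) := by have := Nat.lt_floor_add_one y; linarith
    rcases Nat.lt_or_ge ⌊y⌋₊ ⌈x⌉₊ with h | h
    · rw [Nat.sub_eq_zero_of_le h.le, Nat.cast_zero]
      have h3 : (⌊y⌋₊ : ℝ) < ⌈x⌉₊ := by exact_mod_cast h
      linarith
    · rw [Nat.cast_sub h]
      linarith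
  · intro j hj
    constructor
    · calc x ≤ ⌈x⌉₊ := Nat.le_ceil x
        _ ≤ ((⌈x⌉₊ + j : ℕ) : ℝ) := by exact_mod_cast Nat.le_add_right _ _
    · have h4 : ⌈x⌉₊ + j + 1 ≤ ⌊y⌋₊ := by omega
      have h5 : ((⌈x⌉₊ + j : ℕ) : ℝ) + 1 ≤ ⌊y⌋₊ := by exact_mod_cast h4
      have h6 : (⌊y⌋₊ : ℝ) ≤ y := Nat.floor_le (hx.trans hxy)
      linarith

/-- `cos(1/2) ≥ 7/8`. [folklore] -/
theorem seven_eighths_le_cos_half : (7 : ℝ) / 8 ≤ Real.cos (1 / 2) := by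
  have h := Real.one_sub_sq_div_two_le_cos (x := (1 : ℝ) / 2)
  norm_num at h
  linarith

/-- `arccos c ≥ 1/2` for `c ≤ 7/8`. [folklore] -/
theorem half_le_arccos {c : ℝ} (hc : c ≤ 7 / 8) : 1 / 2 ≤ Real.arccos c := by
  have h1 : Real.arccos (Real.cos (1 / 2)) = 1 / 2 :=
    Real.arccos_cos (by norm_num) (by linarith [Real.pi_gt_three])
  calc (1 : ℝ) / 2 = Real.arccos (Real.cos (1 / 2)) := h1.symm
    _ ≤ Real.arccos c := Real.antitone_arccos (hc.trans seven_eighths_le_cos_half)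

/-- `arccos c ≤ π - 1/2` for `-7/8 ≤ c`. [folklore] -/
theorem arccos_le_pi_sub_half {c : ℝ} (hc : -7 / 8 ≤ c) : Real.arccos c ≤ π - 1 / 2 := by
  have h1 : Real.arccos c ≤ Real.arccos (-(7 / 8)) := Real.antitone_arccos (by linarith)
  rw [Real.arccos_neg] at h1
  linarith [half_le_arccos (le_refl ((7 : ℝ) / 8))]

/-! ### One column: residues just above / just below the level -/

/-- COLUMN WINDOW ABOVE THE LEVEL: if `c = -cos p₁ - μ/2 ∈ [-7/8, 7/8]` and `0 < η ≤ 1`, there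
are `n ≥ 3ηL/16π - 2` consecutive residues `a = A + j < L/2` with
`0 < ε - μ ≤ η`, `ε = -2(cos p₁ + cos(2πa/L))`, and `|c - cos(2πa/L)| ≤ η/2`. [this work] -/
theorem column_window_above (L : ℕ) (hL : 0 < L) (p₁ μ η : ℝ) (hη0 : 0 < η) (hη1 : η ≤ 1)
    (hc1 : -7 / 8 ≤ -Real.cos p₁ - μ / 2) (hc2 : -Real.cos p₁ - μ / 2 ≤ 7 / 8) :
    ∃ A n : ℕ, 3 * η * L / (16 * π) - 2 ≤ n ∧
      ∀ j < n, 2 * ((A + j : ℕ) : ℝ) ≤ L ∧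
        μ < -2 * (Real.cos p₁ + Real.cos (2 * π * ((A + j : ℕ) : ℝ) / L)) ∧
        -2 * (Real.cos p₁ + Real.cos (2 * π * ((A + j : ℕ) : ℝ) / L)) ≤ μ + η ∧
        |(-Real.cos p₁ - μ / 2) - Real.cos (2 * π * ((A + j : ℕ) : ℝ) / L)| ≤ η / 2 := by
  set c := -Real.cos p₁ - μ / 2 with hc
  set θs := Real.arccos c with hθs
  have hLr : (0 : ℝ) < L := by exact_mod_cast hL
  have hθs0 : 0 ≤ θs := Real.arccos_nonneg c
  have hθsπ : θs ≤ π - 1 / 2 := arccos_le_pi_sub_half hc1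
  have hcos : Real.cos θs = c := Real.cos_arccos (by linarith) (by linarith)
  have hxy : L * (θs + η / 8) / (2 * π) ≤ L * (θs + η / 2) / (2 * π) := by
    apply div_le_div_of_nonneg_right _ (by positivity)
    nlinarith
  obtain ⟨A, n, hn, hw⟩ := exists_nat_window (x := L * (θs + η / 8) / (2 * π))
    (y := L * (θs + η / 2) / (2 * π)) (by positivity) hxy
  refine ⟨A, n, ?_, ?_⟩
  · have : L * (θs + η / 2) / (2 * π) - L * (θs + η / 8) / (2 * π) = 3 * η * L / (16 * π) := by
      field_simp
      ring
    linarith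
  · intro j hj
    obtain ⟨hx, hy⟩ := hw j hj
    set a : ℝ := ((A + j : ℕ) : ℝ) with ha
    set θ := 2 * π * a / L with hθ
    -- the angle window
    have hθ1 : θs + η / 8 ≤ θ := by
      rw [hθ, le_div_iff₀ hLr]
      rw [div_le_iff₀ (by positivity)] at hx
      nlinarith
    have hθ2 : θ ≤ θs + η / 2 := by
      rw [hθ, div_le_iff₀ hLr]
      rw [le_div_iff₀ (by positivity)] at hy
      nlinarith
    have hθπ : θ ≤ π := by linarith
    have hlt : Real.cos θ < c := by
      rw [← hcos]
      exact Real.cos_lt_cos_of_nonneg_of_le_pi hθs0 hθπ (by linarith)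
    have hlip : c - Real.cos θ ≤ η / 2 := by
      have h := Real.abs_cos_sub_cos_le θs θ
      rw [hcos, abs_of_nonpos (by linarith : θs - θ ≤ 0)] at h
      linarith [le_abs_self (c - Real.cos θ)]
    refine ⟨?_, ?_, ?_, ?_⟩
    · -- `2a ≤ L` from `θ ≤ π`
      have h1 : 2 * π * a ≤ π * L := by
        rw [hθ, div_le_iff₀ hLr] at hθπ
        linarith
      nlinarith [Real.pi_pos]
    · rw [hc] at hlt
      linarith
    · rw [hc] at hlip
      linarith
    · rw [abs_of_nonneg (by linarith)]
      exact hlip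

/-- COLUMN WINDOW BELOW THE LEVEL: same hypotheses, `n ≥ 3ηL/16π - 2` consecutive residues with
`0 < μ - ε ≤ η` and `|c - cos(2πa/L)| ≤ η/2`. [this work] -/
theorem column_window_below (L : ℕ) (hL : 0 < L) (p₁ μ η : ℝ) (hη0 : 0 < η) (hη1 : η ≤ 1)
    (hc1 : -7 / 8 ≤ -Real.cos p₁ - μ / 2) (hc2 : -Real.cos p₁ - μ / 2 ≤ 7 / 8) :
    ∃ A n : ℕ, 3 * η * L / (16 * π) - 2 ≤ n ∧
      ∀ j < n, 2 * ((A + j : ℕ) : ℝ) ≤ L ∧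
        -2 * (Real.cos p₁ + Real.cos (2 * π * ((A + j : ℕ) : ℝ) / L)) < μ ∧
        μ - η ≤ -2 * (Real.cos p₁ + Real.cos (2 * π * ((A + j : ℕ) : ℝ) / L)) ∧
        |(-Real.cos p₁ - μ / 2) - Real.cos (2 * π * ((A + j : ℕ) : ℝ) / L)| ≤ η / 2 := by
  set c := -Real.cos p₁ - μ / 2 with hc
  set θs := Real.arccos c with hθs
  have hLr : (0 : ℝ) < L := by exact_mod_cast hL
  have hθs0 : 1 / 2 ≤ θs := half_le_arccos hc2
  have hθsπ : θs ≤ π := Real.arccos_le_pi c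
  have hcos : Real.cos θs = c := Real.cos_arccos (by linarith) (by linarith)
  have hx0 : 0 ≤ L * (θs - η / 2) / (2 * π) := by
    apply div_nonneg _ (by positivity)
    nlinarith
  have hxy : L * (θs - η / 2) / (2 * π) ≤ L * (θs - η / 8) / (2 * π) := by
    apply div_le_div_of_nonneg_right _ (by positivity)
    nlinarith
  obtain ⟨A, n, hn, hw⟩ := exists_nat_window hx0 hxy
  refine ⟨A, n, ?_, ?_⟩
  · have : L * (θs - η / 8) / (2 * π) - L * (θs - η / 2) / (2 * π) = 3 * η * L / (16 * π) := by
      field_simp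
      ring
    linarith
  · intro j hj
    obtain ⟨hx, hy⟩ := hw j hj
    set a : ℝ := ((A + j : ℕ) : ℝ) with ha
    set θ := 2 * π * a / L with hθ
    have hθ1 : θs - η / 2 ≤ θ := by
      rw [hθ, le_div_iff₀ hLr]
      rw [div_le_iff₀ (by positivity)] at hx
      nlinarith
    have hθ2 : θ ≤ θs - η / 8 := by
      rw [hθ, div_le_iff₀ hLr]
      rw [le_div_iff₀ (by positivity)] at hy
      nlinarith
    have hθ0 : 0 ≤ θ := by rw [hθ]; positivity
    have hlt : c < Real.cos θ := by
      rw [← hcos]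
      exact Real.cos_lt_cos_of_nonneg_of_le_pi hθ0 hθsπ (by linarith)
    have hlip : Real.cos θ - c ≤ η / 2 := by
      have h := Real.abs_cos_sub_cos_le θ θs
      rw [hcos, abs_of_nonpos (by linarith : θ - θs ≤ 0)] at h
      linarith [le_abs_self (Real.cos θ - c)]
    refine ⟨?_, ?_, ?_, ?_⟩
    · have hθπ : θ ≤ π := by linarith
      have h1 : 2 * π * a ≤ π * L := by
        rw [hθ, div_le_iff₀ hLr] at hθπ
        linarith
      nlinarith [Real.pi_pos]
    · rw [hc] at hlt
      linarith
    · rw [hc] at hlip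
      linarith
    · rw [abs_of_nonpos (by linarith)]
      linarith

/-! ### The admissible columns -/

/-- COLUMN RANGE: for `μ ∈ [-2, 0]` there are `m ≥ L/16π - 2` consecutive residues `a = A + i < L/2`
whose angle `p₁ = 2πa/L` has `c = -cos p₁ - μ/2 ∈ [3/4, 7/8]` (columns `p₁ ∈ [φ₁, φ₁ + 1/8]`,
`φ₁ = arccos(-μ/2 - 3/4)`). [this work] -/
theorem column_range (L : ℕ) (hL : 0 < L) (μ : ℝ) (hμ1 : -2 ≤ μ) (hμ2 : μ ≤ 0) :
    ∃ A m : ℕ, L / (16 * π) - 2 ≤ m ∧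
      ∀ i < m, 2 * ((A + i : ℕ) : ℝ) ≤ L ∧
        3 / 4 ≤ -Real.cos (2 * π * ((A + i : ℕ) : ℝ) / L) - μ / 2 ∧
        -Real.cos (2 * π * ((A + i : ℕ) : ℝ) / L) - μ / 2 ≤ 7 / 8 := by
  set φ₁ := Real.arccos (-μ / 2 - 3 / 4) with hφ₁
  have hLr : (0 : ℝ) < L := by exact_mod_cast hL
  have hφ0 : 0 ≤ φ₁ := Real.arccos_nonneg _
  have hφπ : φ₁ ≤ π - 1 / 2 := arccos_le_pi_sub_half (by linarith)
  have hcosφ : Real.cos φ₁ = -μ / 2 - 3 / 4 := Real.cos_arccos (by linarith) (by linarith)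
  have hxy : L * φ₁ / (2 * π) ≤ L * (φ₁ + 1 / 8) / (2 * π) := by
    apply div_le_div_of_nonneg_right _ (by positivity)
    nlinarith
  obtain ⟨A, m, hm, hw⟩ := exists_nat_window (x := L * φ₁ / (2 * π))
    (y := L * (φ₁ + 1 / 8) / (2 * π)) (by positivity) hxy
  refine ⟨A, m, ?_, ?_⟩
  · have : L * (φ₁ + 1 / 8) / (2 * π) - L * φ₁ / (2 * π) = L / (16 * π) := by
      field_simp
      ring
    linarith
  · intro i hi
    obtain ⟨hx, hy⟩ := hw i hi
    set a : ℝ := ((A + i : ℕ) : ℝ) with ha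
    set φ := 2 * π * a / L with hφ
    have hφ1' : φ₁ ≤ φ := by
      rw [hφ, le_div_iff₀ hLr]
      rw [div_le_iff₀ (by positivity)] at hx
      nlinarith
    have hφ2' : φ ≤ φ₁ + 1 / 8 := by
      rw [hφ, div_le_iff₀ hLr]
      rw [le_div_iff₀ (by positivity)] at hy
      nlinarith
    have hφπ' : φ ≤ π := by linarith
    have hle : Real.cos φ ≤ Real.cos φ₁ := Real.cos_le_cos_of_nonneg_of_le_pi hφ0 hφπ' hφ1'
    have hlip : Real.cos φ₁ - Real.cos φ ≤ 1 / 8 := by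
      have h := Real.abs_cos_sub_cos_le φ₁ φ
      rw [abs_of_nonpos (by linarith : φ₁ - φ ≤ 0)] at h
      linarith [le_abs_self (Real.cos φ₁ - Real.cos φ)]
    refine ⟨?_, ?_, ?_⟩
    · have h1 : 2 * π * a ≤ π * L := by
        rw [hφ, div_le_iff₀ hLr] at hφπ'
        linarith
      nlinarith [Real.pi_pos]
    · rw [hcosφ] at hle
      linarith
    · rw [hcosφ] at hlip
      linarith

/-! ### Assembly: the momenta `k = (A₁ + i, A₂(i) + j)` -/

/-- The band and the profile at a momentum with prescribed small residues. [folklore] -/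
theorem band_and_profile_of_cast {L : ℕ} [NeZero L] {a b : ℕ} (ha : a < L) (hb : b < L) :
    torusBand L (![((a : ℕ) : ZMod L), ((b : ℕ) : ZMod L)] : TorusSite 2 L) =
      -2 * (Real.cos (2 * π * (a : ℝ) / L) + Real.cos (2 * π * (b : ℝ) / L)) ∧
    pairFieldMode dWaveFormFactor L (![((a : ℕ) : ZMod L), ((b : ℕ) : ZMod L)] : TorusSite 2 L) =
      2 * Real.sqrt 2 * (Real.cos (2 * π * (a : ℝ) / L) - Real.cos (2 * π * (b : ℝ) / L)) := by
  have h0 : latticeMomentum L (![((a : ℕ) : ZMod L), ((b : ℕ) : ZMod L)] : TorusSite 2 L) 0 =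
      2 * π * (a : ℝ) / L := by
    show 2 * π * ((((![((a : ℕ) : ZMod L), ((b : ℕ) : ZMod L)] : TorusSite 2 L) 0).val : ℕ) : ℝ)
      / L = _
    simp [ZMod.val_cast_of_lt ha]
  have h1 : latticeMomentum L (![((a : ℕ) : ZMod L), ((b : ℕ) : ZMod L)] : TorusSite 2 L) 1 =
      2 * π * (b : ℝ) / L := by
    show 2 * π * ((((![((a : ℕ) : ZMod L), ((b : ℕ) : ZMod L)] : TorusSite 2 L) 1).val : ℕ) : ℝ)
      / L = _
    simp [ZMod.val_cast_of_lt hb]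
  constructor
  · unfold torusBand
    rw [Fin.sum_univ_two, h0, h1]
  · rw [pairFieldMode_dWaveFormFactor]
    unfold dWaveGap
    rw [h0, h1]

/-- GENERIC COLUMN COUNT: if `m ≥ s` columns `A + i` each carry `n_i ≥ t ≥ 0` residues
`A₂(i) + j` whose momentum satisfies `P`, then `#{k : P k} ≥ s·t`. [this work] -/
theorem card_filter_ge_of_columns {L : ℕ} [NeZero L] (P : TorusSite 2 L → Prop)
    [DecidablePred P] {A m : ℕ} {s t : ℝ} (hsm : s ≤ m) (ht0 : 0 ≤ t)
    (hltA : ∀ i < m, A + i < L)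
    (key : ∀ i, i < m → ∃ A₂ n : ℕ, t ≤ n ∧ ∀ j < n, A₂ + j < L ∧
      P (![(((A + i : ℕ)) : ZMod L), (((A₂ + j : ℕ)) : ZMod L)] : TorusSite 2 L)) :
    s * t ≤ #(univ.filter P) := by
  choose! A₂ n hn hwin using key
  set N₀ : ℕ := ⌈t⌉₊ with hN₀
  have hN₀n : ∀ i < m, N₀ ≤ n i := fun i hi => Nat.ceil_le.mpr (hn i hi)
  let f : ℕ × ℕ → TorusSite 2 L := fun ij =>
    ![(((A + ij.1 : ℕ)) : ZMod L), (((A₂ ij.1 + ij.2 : ℕ)) : ZMod L)]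
  have hmaps : ∀ ij ∈ (range m) ×ˢ (range N₀), f ij ∈ univ.filter P := by
    rintro ⟨i, j⟩ hij
    rw [mem_product, mem_range, mem_range] at hij
    obtain ⟨hi, hj⟩ := hij
    rw [mem_filter]
    exact ⟨mem_univ _, (hwin i hi j (lt_of_lt_of_le hj (hN₀n i hi))).2⟩
  have hinj : Set.InjOn f ((range m) ×ˢ (range N₀) : Finset (ℕ × ℕ)) := by
    rintro ⟨i, j⟩ hij ⟨i', j'⟩ hij' heq
    rw [coe_product, Set.mem_prod, coe_range, coe_range, Set.mem_Iio, Set.mem_Iio] at hij hij'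
    have h0 := congr_fun heq 0
    have h1 := congr_fun heq 1
    simp only [f, Matrix.cons_val_zero, Matrix.cons_val_one, Matrix.cons_val_fin_one] at h0 h1
    have h0' := congr_arg ZMod.val h0
    rw [ZMod.val_cast_of_lt (hltA i hij.1), ZMod.val_cast_of_lt (hltA i' hij'.1)] at h0'
    have hii : i = i' := by omega
    subst hii
    have h1' := congr_arg ZMod.val h1
    rw [ZMod.val_cast_of_lt (hwin i hij.1 j (lt_of_lt_of_le hij.2 (hN₀n i hij.1))).1,
      ZMod.val_cast_of_lt (hwin i hij.1 j' (lt_of_lt_of_le hij'.2 (hN₀n i hij'.1))).1] at h1'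
    have hjj : j = j' := by omega
    rw [hjj]
  have hcard := card_le_card_of_injOn f hmaps hinj
  rw [card_product, card_range, card_range] at hcard
  have hN₀t : t ≤ (N₀ : ℝ) := Nat.le_ceil t
  have hmN : (m : ℝ) * N₀ ≤ #(univ.filter P) := by exact_mod_cast hcard
  calc s * t ≤ (m : ℝ) * N₀ := mul_le_mul hsm hN₀t ht0 (Nat.cast_nonneg m)
    _ ≤ _ := hmN

/-- From `|c - cos p₂| ≤ η/2 ≤ 1/4` and `3/4 ≤ c`, `μ ≥ -2` (so `cos p₁ - c = 2cos p₁ + μ/2 ≤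
-1/2`): `|w| = 2√2|cos p₁ - cos p₂| ≥ √2/2`. [this work] -/
theorem profile_ge_of_column {μ η x y : ℝ} (hμ1 : -2 ≤ μ) (hη1 : η ≤ 1 / 2)
    (hc1 : 3 / 4 ≤ -x - μ / 2) (habs : |(-x - μ / 2) - y| ≤ η / 2) :
    Real.sqrt 2 / 2 ≤ |2 * Real.sqrt 2 * (x - y)| := by
  rw [abs_mul, abs_of_pos (by positivity : (0 : ℝ) < 2 * Real.sqrt 2)]
  have h1 : x - y ≤ -1 / 4 := by
    have h2 := (abs_le.1 habs).2
    linarith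
  have h3 : (1 : ℝ) / 4 ≤ |x - y| := by
    rw [abs_of_nonpos (by linarith)]
    linarith
  have hs : Real.sqrt 2 / 2 = 2 * Real.sqrt 2 * (1 / 4) := by ring
  rw [hs]
  exact mul_le_mul_of_nonneg_left h3 (by positivity)

/-- `2a ≤ L` (reals, `a : ℕ`, `0 < L`) gives `a < L`. [folklore] -/
theorem lt_of_two_mul_cast_le {a L : ℕ} (hL : 0 < L) (h : 2 * (a : ℝ) ≤ L) : a < L := by
  have hLr : (0 : ℝ) < L := by exact_mod_cast hL
  exact_mod_cast (by linarith : (a : ℝ) < L)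

/-- **Theorem 27a (shell above the level).** For `μ ∈ [-2, 0]`, `0 < η ≤ 1/2` and `3ηL ≥ 32π`:
`#{k : μ < ε_L(k) ≤ μ + η, |w_d(k)| ≥ √2/2} ≥ (L/16π - 2)(3ηL/16π - 2)`. [this work] -/
theorem card_shell_above_ge (L : ℕ) [NeZero L] (μ η : ℝ) (hμ1 : -2 ≤ μ) (hμ2 : μ ≤ 0)
    (hη0 : 0 < η) (hη1 : η ≤ 1 / 2) (hηL : 32 * π ≤ 3 * η * L) :
    (L / (16 * π) - 2) * (3 * η * L / (16 * π) - 2) ≤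
      #(univ.filter fun k : TorusSite 2 L => μ < torusBand L k ∧ torusBand L k ≤ μ + η ∧
        Real.sqrt 2 / 2 ≤ |pairFieldMode dWaveFormFactor L k|) := by
  have hL : 0 < L := Nat.pos_of_ne_zero (NeZero.ne L)
  obtain ⟨A, m, hm, hcol⟩ := column_range L hL μ hμ1 hμ2
  have ht0 : 0 ≤ 3 * η * L / (16 * π) - 2 := by
    rw [sub_nonneg, le_div_iff₀ (by positivity)]
    linarith
  refine card_filter_ge_of_columns _ hm ht0
    (fun i hi => lt_of_two_mul_cast_le hL (hcol i hi).1) ?_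
  intro i hi
  obtain ⟨h2A, hc1, hc2⟩ := hcol i hi
  obtain ⟨A₂, n, hn, hwin⟩ :=
    column_window_above L hL (2 * π * ((A + i : ℕ) : ℝ) / L) μ η hη0 (by linarith) (by linarith) hc2
  refine ⟨A₂, n, hn, fun j hj => ?_⟩
  obtain ⟨h2B, hlo, hhi, habs⟩ := hwin j hj
  have hltA := lt_of_two_mul_cast_le hL h2A
  have hltB := lt_of_two_mul_cast_le hL h2B
  obtain ⟨hband, hprof⟩ := band_and_profile_of_cast (L := L) hltA hltB
  refine ⟨hltB, ?_, ?_, ?_⟩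
  · rw [hband]; exact hlo
  · rw [hband]; exact hhi
  · rw [hprof]; exact profile_ge_of_column hμ1 hη1 hc1 habs

/-- **Theorem 27b (shell below the level).** For `μ ∈ [-2, 0]`, `0 < η ≤ 1/2` and `3ηL ≥ 32π`:
`#{k : μ - η ≤ ε_L(k) < μ, |w_d(k)| ≥ √2/2} ≥ (L/16π - 2)(3ηL/16π - 2)`. [this work] -/
theorem card_shell_below_ge (L : ℕ) [NeZero L] (μ η : ℝ) (hμ1 : -2 ≤ μ) (hμ2 : μ ≤ 0)
    (hη0 : 0 < η) (hη1 : η ≤ 1 / 2) (hηL : 32 * π ≤ 3 * η * L) :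
    (L / (16 * π) - 2) * (3 * η * L / (16 * π) - 2) ≤
      #(univ.filter fun k : TorusSite 2 L => μ - η ≤ torusBand L k ∧ torusBand L k < μ ∧
        Real.sqrt 2 / 2 ≤ |pairFieldMode dWaveFormFactor L k|) := by
  have hL : 0 < L := Nat.pos_of_ne_zero (NeZero.ne L)
  obtain ⟨A, m, hm, hcol⟩ := column_range L hL μ hμ1 hμ2
  have ht0 : 0 ≤ 3 * η * L / (16 * π) - 2 := by
    rw [sub_nonneg, le_div_iff₀ (by positivity)]
    linarith
  refine card_filter_ge_of_columns _ hm ht0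
    (fun i hi => lt_of_two_mul_cast_le hL (hcol i hi).1) ?_
  intro i hi
  obtain ⟨h2A, hc1, hc2⟩ := hcol i hi
  obtain ⟨A₂, n, hn, hwin⟩ :=
    column_window_below L hL (2 * π * ((A + i : ℕ) : ℝ) / L) μ η hη0 (by linarith) (by linarith) hc2
  refine ⟨A₂, n, hn, fun j hj => ?_⟩
  obtain ⟨h2B, hlo, hhi, habs⟩ := hwin j hj
  have hltA := lt_of_two_mul_cast_le hL h2A
  have hltB := lt_of_two_mul_cast_le hL h2B
  obtain ⟨hband, hprof⟩ := band_and_profile_of_cast (L := L) hltA hltB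
  refine ⟨hltB, ?_, ?_, ?_⟩
  · rw [hband]; exact hhi
  · rw [hband]; exact hlo
  · rw [hprof]; exact profile_ge_of_column hμ1 hη1 hc1 habs

end Summit.HubbardSuperconductivity.HubbardSuperconductivity.Theorems.FermiSurfaceDOS
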